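import Summits.NavierStokesRegularity.FunctionalMining.TopEigGapCoerciveFloor
import Summits.NavierStokesRegularity.FunctionalMining.NegBotEigGapCoercive
import HarnessLib

/-!
# FunctionalMining — the FLOOR-CLASS NODE transported to the `−λ₃` core: `Ψ_q = ∫((−λ₃)⁺)^q` is heat-coercive on the
# BOTTOM-GAP + (−λ₃)-AMPLITUDE-FLOOR class for every real `5/3 ≤ q ≤ 2` (mirror of `TopEigGapCoerciveFloor`)

HONEST FRAMING. Search for candidate a priori estimates; no regularity claim. Nothing about Navier–Stokes is
proved or asserted in this file. Cell `pub-nsfunc`, prove seat (gen 31), own lane; symmetry bookkeeping on top of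
the floor-class node of the (LL) programme below `q = 2` (`TopEigGapCoerciveFloor.topEigHeatCoerciveOn_gap_floor`:
for `5/3 ≤ q ≤ 2`, `0 < η ≤ 1`, `κ > 0` there is `c > 0` with `HeatCoerciveOn (StrainGapClass η ∧ κΦ_q^{1/q} ≤ λ₁) Φ_q c`
on `T³`), exactly as `NegBotEigGapCoercive` transported Proposition L-λ(η) (`TopEigGapCoercivePos`) to the `−λ₃` core:
under `v ↦ −v` the sorted strain eigenvalues map `(λ₁, λ₂, λ₃) ↦ (−λ₃, −λ₂, −λ₁)`, `Φ_q(−v) = Ψ_q(v)`, the heat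
prices agree (`heatDissipation_topEigMoment_neg`), the top-gap class of `−v` is the bottom-gap class of `v`
(`strainGapClass_neg_iff`) and the `λ₁`-floor of `−v` is the `(−λ₃)`-floor of `v` (`torusStrainTopEig_neg`).

CONTENT. `heatCoerciveOn_negBot_floor_iff` (rate by rate, every real `q, η, κ, c`): `Ψ_q` is heat-coercive at
rate `c` on `{(1−η)λ₃ ≤ λ₂} ∧ {κΨ_q^{1/q} ≤ −λ₃}` iff `Φ_q` is at rate `c` on `StrainGapClass η ∧ {κΦ_q^{1/q} ≤ λ₁}`;
**`negBotEigHeatCoerciveOn_gap_floor`** (`5/3 ≤ q ≤ 2`, `0 < η ≤ 1`, `κ > 0`): `∃ c > 0, HeatCoerciveOn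
({(1−η)λ₃ ≤ λ₂} ∧ {∀ x, κΨ_q(v)^{1/q} ≤ −λ₃(x)}) Ψ_q c`; `…_floor'` for every `η > 0`.
MEANING (records only). A CLASS statement = design rule for the `−λ₃` core: a family killing the one-sided node
`NegBotEigHeatCoercivePos q`, `q ∈ [5/3, 2]`, must leave the bottom-gap class or lose its `(−λ₃)`-amplitude floor.
NOT CLAIMED: the one-sided nodes themselves (OPEN in the kernel for every real `q > 1`), `q < 5/3` (that is
`TopEigGapCoerciveFloorLow`'s range, to be mirrored the same way), any constant, Navier–Stokes regularity. [ours]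
FILING (prove seat g33, SLOT OWN-M5, LEAD (eeeeeeee) INBOX l.5667, queued (59g) l.5806 / (59m) l.5827): = staged `pub-nsfunc-prove/staged/g31-own/NegBotEigGapCoerciveFloor.lean` 4183b30ab5c91a3f; this line is the only addition.
-/

noncomputable section

open Finset MeasureTheory

namespace Summit.NavierStokesRegularity.FunctionalMining

open Literature.Analysis Literature.Analysis.FunctionSpaces Literature.Analysis.FunctionSpaces.Torus

namespace TopEig

variable {d : Type*} [Fintype d] [DecidableEq d]

/-- **The `λ₁`-amplitude floor of `−v` is the `(−λ₃)`-amplitude floor of `v`** (every real `q, κ`). [ours, bookkeeping] -/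
theorem topEigFloor_neg_iff (q κ : ℝ) (v : UnitAddTorus d → EuclideanSpace ℝ d) :
    (∀ x, κ * torusTopEigMoment q (-v) ^ (1 / q) ≤ torusStrainTopEig (-v) x) ↔
      ∀ x, κ * torusNegBotEigMoment q v ^ (1 / q) ≤ -torusStrainBotEig v x := by
  simp only [torusTopEigMoment_neg, torusStrainTopEig_neg]

/-- The `(−λ₃)`-amplitude floor of `−v` is the `λ₁`-amplitude floor of `v`. [ours, bookkeeping] -/
theorem negBotEigFloor_neg_iff (q κ : ℝ) (v : UnitAddTorus d → EuclideanSpace ℝ d) :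
    (∀ x, κ * torusNegBotEigMoment q (-v) ^ (1 / q) ≤ -torusStrainBotEig (-v) x) ↔
      ∀ x, κ * torusTopEigMoment q v ^ (1 / q) ≤ torusStrainTopEig v x := by
  simp only [torusNegBotEigMoment_neg, torusStrainBotEig_neg, neg_neg]

/-- **Rate by rate:** `Ψ_q` is heat-coercive at rate `c` on the bottom-gap + `(−λ₃)`-floor class iff `Φ_q` is
heat-coercive at rate `c` on the top-gap + `λ₁`-floor class (every real `q, η, κ, c`). [ours, bookkeeping] -/
theorem heatCoerciveOn_negBot_floor_iff (q η κ c : ℝ) :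
    HeatCoerciveOn (fun v : UnitAddTorus d → EuclideanSpace ℝ d =>
        (∀ x, (1 - η) * torusStrainBotEig v x ≤ torusStrainMidEig v x) ∧
          ∀ x, κ * torusNegBotEigMoment q v ^ (1 / q) ≤ -torusStrainBotEig v x) (torusNegBotEigMoment q) c ↔
      HeatCoerciveOn (fun v : UnitAddTorus d → EuclideanSpace ℝ d =>
        StrainGapClass η v ∧ ∀ x, κ * torusTopEigMoment q v ^ (1 / q) ≤ torusStrainTopEig v x)
        (torusTopEigMoment q) c := by
  constructor
  · intro h hd v hv hdiv hmean hP
    have h' := h hd (-v) hv.neg ((torus_isDivFree_neg_iff v).2 hdiv) ((torus_hasZeroMean_neg_iff v).2 hmean)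
      ⟨(botGapClass_neg_iff η v).2 hP.1, (negBotEigFloor_neg_iff q κ v).2 hP.2⟩
    rwa [torusNegBotEigMoment_neg, heatDissipation_negBotEigMoment_neg] at h'
  · intro h hd v hv hdiv hmean hP
    have h' := h hd (-v) hv.neg ((torus_isDivFree_neg_iff v).2 hdiv) ((torus_hasZeroMean_neg_iff v).2 hmean)
      ⟨(strainGapClass_neg_iff η v).2 hP.1, (topEigFloor_neg_iff q κ v).2 hP.2⟩
    rwa [torusTopEigMoment_neg, heatDissipation_topEigMoment_neg] at h'

/-- **THE FLOOR-CLASS NODE FOR THE `−λ₃` CORE ON `T³`, `5/3 ≤ q ≤ 2`, `0 < η ≤ 1`, `κ > 0`:** there is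
`c > 0` with `c · Ψ_q(v) ≤ heatDissipation Ψ_q v` for every smooth, divergence-free, zero-mean `v` with the bottom
gap `(1 − η)λ₃ ≤ λ₂` and the amplitude floor `κ Ψ_q(v)^{1/q} ≤ −λ₃(x)` at every point (the own-lane node
`topEigHeatCoerciveOn_gap_floor` transported by `v ↦ −v`). [ours] -/
theorem negBotEigHeatCoerciveOn_gap_floor {q η κ : ℝ} (hq : 5 / 3 ≤ q) (hq2 : q ≤ 2) (hη0 : 0 < η)
    (hη1 : η ≤ 1) (hκ : 0 < κ) :
    ∃ c : ℝ, 0 < c ∧ HeatCoerciveOn (fun v : UnitAddTorus (Fin 3) → EuclideanSpace ℝ (Fin 3) =>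
        (∀ x, (1 - η) * torusStrainBotEig v x ≤ torusStrainMidEig v x) ∧
          ∀ x, κ * torusNegBotEigMoment q v ^ (1 / q) ≤ -torusStrainBotEig v x) (torusNegBotEigMoment q) c := by
  obtain ⟨c, hc, h⟩ := topEigHeatCoerciveOn_gap_floor hq hq2 hη0 hη1 hκ
  exact ⟨c, hc, (heatCoerciveOn_negBot_floor_iff q η κ c).2 h⟩

/-- The same for every `η > 0` (via `topEigHeatCoerciveOn_gap_floor'`). [ours] -/
theorem negBotEigHeatCoerciveOn_gap_floor' {q η κ : ℝ} (hq : 5 / 3 ≤ q) (hq2 : q ≤ 2) (hη0 : 0 < η)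
    (hκ : 0 < κ) :
    ∃ c : ℝ, 0 < c ∧ HeatCoerciveOn (fun v : UnitAddTorus (Fin 3) → EuclideanSpace ℝ (Fin 3) =>
        (∀ x, (1 - η) * torusStrainBotEig v x ≤ torusStrainMidEig v x) ∧
          ∀ x, κ * torusNegBotEigMoment q v ^ (1 / q) ≤ -torusStrainBotEig v x) (torusNegBotEigMoment q) c := by
  obtain ⟨c, hc, h⟩ := topEigHeatCoerciveOn_gap_floor' hq hq2 hη0 hκ
  exact ⟨c, hc, (heatCoerciveOn_negBot_floor_iff q η κ c).2 h⟩

end TopEig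

end Summit.NavierStokesRegularity.FunctionalMining

end
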